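import Summits.QuantumFields.BalabanUV.Beta.RemainderExplicitHistoryDiagonalRateThreshold
import Summits.QuantumFields.BalabanUV.Beta.RemainderExplicitHistoryDiagonalRatePowerShapes

/-!
# RemainderExplicitHistoryDiagonalRatePowerTail — ROAD P3, ORDER-0 PROFILE FAMILY: THE RATE IN THE CUTOFF FOR EVERY POWER TAIL — for a
# pinned family of runs whose memory profile has tails `Σ_{a∈[k,N)} ρ(a) ≤ T₀∕(k+1)^q` (`0 < q < 1`; `Wγ < b`):
# `astar g m − invSq g m n ≤ Λ₄·√m·T₀∕(n+2)^q` for `T₀(4∕(1−q)+2∕q) ≤ b√b·√m`, `m ≤ n+1` (`Λ₄ = 4∕√b + 32√2κ∕((1−Wγ∕b)√b)`), at every smaller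
# `m` with the sixth file's factor; with tails `≥ T₁∕(k+1)^q` SOME `m′ ≤ m` has `√m·T₁∕(n+m+1)^q ≤ 8κ₂√b₂(1+Wγ∕b)·(astar g m′ − invSq g m′
# (n+m−m′))` (no smallness); the POWER PROFILE `ρ(a) = M₀∕((a+1)^q(a+1))` has such tails with `T₀ = M₀(1 + 2∕q)`, `T₁ = M₀∕4`: road P3's
# polynomial profiles reach their continuum coupling at the two-sided RATE `√m∕n^q` (eighth file of station S-d4p3-g49-1 «the rate in the
# cutoff»)

Cell `pub-balaban`, β-function sub-cell, BINDER row D4 «RemainderConst leaves for Bałaban's split» (`HOME/BINDER-OWNERS.md`; owner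
lineage `b2b-balaban-beta-an4`; this file by co-owner #3 lineage `b2b-balaban-beta-d4-p3`, road P3 «the reduction road», generation 49,
station S-d4p3-g49-1, eighth file; imports the station's sixth file `RemainderExplicitHistoryDiagonalRateThreshold` (hence files 3–5) and
the seventh `RemainderExplicitHistoryDiagonalRatePowerShapes` (Bernoulli ∕ Abel shape constants)), β-FLOW TEAM duty (1); FREEZE (0)
honoured (def-free module in road P3's own `RemainderExplicit*` series; no leaf, no interface, no Literature file).  SOURCE OF THE SHAPES
ONLY: [Balaban1987RG1] (0.20) p. 256, (0.31) and Thm 2 p. 259, §5 p. 298.  Pure real analysis about ONE explicit toy family (ours).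

HONEST FRAMING (page 1 of everything the β sub-cell writes).  *"Discharging BetaPertH makes Bałaban's UV stability UNCONDITIONAL — a real
constructive-QFT result; it is NOT the continuum limit and NOT the Clay problem."*  THIS FILE DISCHARGES NOTHING OF THE KIND.  It closes
the station: the third file's abstract rate theorem, the fourth's lower side and the sixth's threshold transfer are instantiated on the
whole POLYNOMIAL class — every profile whose tails are `O(k^{−q})`, `0 < q < 1` (§1), in particular road P3's power profiles
`ρ(a) = M₀∕(a+1)^{1+q}` (§2: their tails are `≤ M₀(1+2∕q)∕(k+1)^q` by the seventh file's `(1+q)`-tail and `≥ (M₀∕4)∕(k+1)^q` by the block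
`[k, 2k)`).  With generation 47 (EXISTENCE from summability) and generation 48 (m-UNIFORMITY iff `Σρ(a)min(a,m)² = O(m^{3∕2})`, i.e. `q ≥ 1∕2`
for power tails) the census of road P3's order-0 family now reads, for the profile `a^{−(1+q)}`: the continuum coupling exists for every
`q > 0`, the cutoff discrepancy `astar g m − invSq g m 0` is bounded in `m` iff `q ≥ 1∕2`, and at every infrared distance `m ≤ n+1` the
lattice value at cutoff `n` is within `≍ √m∕n^q` of the continuum one (upper side under `Wγ < b`; lower side for the running maximum over
`m′ ≤ m`, no smallness).  Nothing of Bałaban's (1.22) is asserted or constructed; row D4 class UNCHANGED (critical-path width 0; instance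
0∕1; D4 DISCHARGE NO DATE); NOT B12 Thm 2, NOT BetaPertH, NOT continuum, NOT Clay.  HONEST DEPENDENCY: continuum YM on T⁴ ⇐ BetaPertH ∧
nine spine estimates (0/9 proved); BetaPertH ⇐ (D1) ∧ (D4) ∧ CAP+tail; G-an2-4 gates asym, D1 and NE2/3/4.  ABSOLUTE RULE: nothing is
cited as a fact.

WHAT IS PROVED ([folklore]; 0 sorry; 0 `def`).
* §1 THE TAIL CLASS `R(N) − R(k) ≤ T₀∕(k+1)^q`: `powerTail_antitone`, **`powerTail_rate`** (`astar g m − invSq g m n ≤ Λ₄√m·T₀∕(n+2)^q`,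
  `T₀(4∕(1−q)+2∕q) ≤ b√b√m`, `m ≤ n+1`), **`powerTail_rate_threshold`** (`m ≤ σ₀`, `2σ₀ ≤ n+m+1`: `≤ (1+Wγ³∕2)^{σ₀−m}Λ₄√σ₀·T₀∕(n+m+2−σ₀)^q`),
  **`powerTail_rate_lower`** (minorant `T₁∕(k+1)^q` ⇒ `∃ m′ ≤ m`, `√m·T₁∕(n+m+1)^q ≤ 8κ₂√b₂(1+Wγ∕b)(astar g m′ − invSq g m′ (n+m−m′))`).
* §2 THE POWER PROFILE `ρ(a) = M₀∕((a+1)^q·(a+1))`: `powerProfile_tail_le` (`T₀ = M₀(1+2∕q)`), `powerProfile_tail_ge` (`T₁ = M₀∕4`),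
  **`powerProfile_rate`**, **`powerProfile_rate_lower`**.
All letters NOT-IN-PRINT; `BetaFlowAsPrinted S` records a Markov β_n only ⇒ no junction of the as-printed interface changes.
-/

noncomputable section

open Finset Filter Topology

namespace Summit.QuantumFields.BalabanUV.Beta.RemainderExplicitHistoryDiagonalRatePowerTail

open Literature.MathematicalPhysics.QuantumFieldTheory.Balaban1983to89
open Literature.MathematicalPhysics.QuantumFieldTheory.Balaban1983to89.FlowStep
open Literature.MathematicalPhysics.QuantumFieldTheory.Balaban1983to89.T4CouplingMatching
open Literature.MathematicalPhysics.QuantumFieldTheory.Balaban1983to89.T4ContinuumCoupling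
open Summit.QuantumFields.BalabanUV.Beta.RemainderExplicitHistoryDiagonalRate
open Summit.QuantumFields.BalabanUV.Beta.RemainderExplicitHistoryDiagonalRateLower
open Summit.QuantumFields.BalabanUV.Beta.RemainderExplicitHistoryDiagonalRateThreshold
open Summit.QuantumFields.BalabanUV.Beta.RemainderExplicitHistoryDiagonalRatePowerShapes

variable {β : HBeta} {b γ W : ℝ} {ρ : ℕ → ℝ}

/-! ## §1 The tail class `R(N) − R(k) ≤ T₀∕(k+1)^q`, `0 < q < 1` -/

/-- `k ↦ T∕(k+1)^q` is non-increasing for `T ≥ 0`, `q ≥ 0`. [folklore] -/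
theorem powerTail_antitone {T q : ℝ} (hT : 0 ≤ T) (hq : 0 ≤ q) {k l : ℕ} (hkl : k ≤ l) :
    T / ((l : ℝ) + 1) ^ q ≤ T / ((k : ℝ) + 1) ^ q :=
  div_le_div_of_nonneg_left hT (Real.rpow_pos_of_pos (by positivity) q)
    (Real.rpow_le_rpow (by positivity) (by exact_mod_cast Nat.add_le_add_right hkl 1) hq)

/-- **ROAD P3 — THE RATE IN THE CUTOFF FOR EVERY POWER TAIL, UPPER SIDE.**  A family `K ↦ g K` of runs of the order-0 profile family in
]0,γ] pinned at one `g_IR` (`b > 0`, `ρ ≥ 0`, `Σ_{a<N} ρ_a ≤ W`, `Wγ < b`) whose profile has POWER TAILS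
`Σ_{a<N} ρ(a) − Σ_{a<k} ρ(a) ≤ T₀∕(k+1)^q` (`k ≤ N`; `0 < q < 1`, `T₀ ≥ 0`).  THEN for every infrared distance `m` with
`T₀(4∕(1−q) + 2∕q) ≤ b√b·√m` and every cutoff `n ≥ m − 1`:  `0 ≤ astar g m − invSq g m n ≤ Λ₄·√m·T₀∕(n+2)^q`,
`Λ₄ = 4∕√b + 32√2κ∕((1−Wγ∕b)√b)` — the third file's `astar_sub_invSq_le_rate` with the seventh file's shapes `A₁ = 4`, `A₂ = T₀(4∕(1−q)+2∕q)`.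
[cite: Balaban1987RG1, (0.20) p.256, (0.31) and Thm 2 p.259] -/
theorem powerTail_rate {T₀ q : ℝ}
    (hβ : ∀ (k : ℕ) (p : Fin (k + 1) → ℝ),
      β k p = b + ∑ i : Fin (k + 1), ρ (k - i) * min (p (Fin.last k)) (|p (Fin.last k) - p i|))
    (hb : 0 < b) (hγ : 0 < γ) (hρ0 : ∀ a, 0 ≤ ρ a) (hρW : ∀ n, ∑ a ∈ range n, ρ a ≤ W) (hsmall : W * γ < b)
    (hq0 : 0 < q) (hq1 : q < 1) (hT₀ : 0 ≤ T₀)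
    (hτ : ∀ k N : ℕ, k ≤ N → ∑ a ∈ range N, ρ a - ∑ a ∈ range k, ρ a ≤ T₀ / ((k : ℝ) + 1) ^ q)
    {g : ℕ → ℕ → ℝ} {gIR : ℝ} (hrun : ∀ K, RGEqH K β (g K)) (hbox : ∀ K i, i ≤ K → 0 < g K i ∧ g K i ≤ γ)
    (hpin : ∀ K, g K K = gIR) {m n : ℕ} (hm : T₀ * (4 / (1 - q) + 2 / q) ≤ b * Real.sqrt b * Real.sqrt (m : ℝ)) (hmn : m ≤ n + 1) :
    0 ≤ astar g m - invSq g m n ∧ astar g m - invSq g m n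
      ≤ (4 / Real.sqrt b + 8 * Real.sqrt 2 * ((b + W * γ) / b) * 4 / ((1 - W * γ / b) * Real.sqrt b))
        * Real.sqrt (m : ℝ) * (T₀ / ((((n + 1 : ℕ) : ℝ)) + 1) ^ q) :=
  astar_sub_invSq_le_rate (τ := fun k => T₀ / ((k : ℝ) + 1) ^ q) (A₁ := 4) (A₂ := T₀ * (4 / (1 - q) + 2 / q))
    hβ hb hγ hρ0 hρW hsmall (fun k => by positivity) (fun _ _ hkl => powerTail_antitone hT₀ hq0.le hkl) hτ (by norm_num)
    (fun K N hK => powerTail_T1 hq0 hq1 hT₀ hτ K N hK) (fun j₀ => powerTail_T2 hq0 hq1 j₀) hrun hbox hpin hm hmn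

/-- **THE SAME BELOW THE THRESHOLD DISTANCE** (sixth file): with a threshold `σ₀`, `T₀(4∕(1−q) + 2∕q) ≤ b√b·√σ₀`, for every `m ≤ σ₀` and
`n` with `2σ₀ ≤ n+m+1`: `astar g m − invSq g m n ≤ (1+Wγ³∕2)^{σ₀−m}·Λ₄√σ₀·T₀∕(n+m+2−σ₀)^q`. [cite: Balaban1987RG1, (0.20) p.256, (0.31) and Thm 2 p.259] -/
theorem powerTail_rate_threshold {T₀ q : ℝ}
    (hβ : ∀ (k : ℕ) (p : Fin (k + 1) → ℝ),
      β k p = b + ∑ i : Fin (k + 1), ρ (k - i) * min (p (Fin.last k)) (|p (Fin.last k) - p i|))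
    (hb : 0 < b) (hγ : 0 < γ) (hρ0 : ∀ a, 0 ≤ ρ a) (hρW : ∀ n, ∑ a ∈ range n, ρ a ≤ W) (hsmall : W * γ < b)
    (hq0 : 0 < q) (hq1 : q < 1) (hT₀ : 0 ≤ T₀)
    (hτ : ∀ k N : ℕ, k ≤ N → ∑ a ∈ range N, ρ a - ∑ a ∈ range k, ρ a ≤ T₀ / ((k : ℝ) + 1) ^ q)
    {g : ℕ → ℕ → ℝ} {gIR : ℝ} (hrun : ∀ K, RGEqH K β (g K)) (hbox : ∀ K i, i ≤ K → 0 < g K i ∧ g K i ≤ γ)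
    (hpin : ∀ K, g K K = gIR) {σ₀ m n : ℕ} (hσ₀ : T₀ * (4 / (1 - q) + 2 / q) ≤ b * Real.sqrt b * Real.sqrt (σ₀ : ℝ))
    (hm : m ≤ σ₀) (hn : 2 * σ₀ ≤ n + m + 1) :
    0 ≤ astar g m - invSq g m n ∧ astar g m - invSq g m n
      ≤ (1 + W * γ ^ 3 / 2) ^ (σ₀ - m)
        * ((4 / Real.sqrt b + 8 * Real.sqrt 2 * ((b + W * γ) / b) * 4 / ((1 - W * γ / b) * Real.sqrt b))
          * Real.sqrt (σ₀ : ℝ) * (T₀ / (((n + m + 1 - σ₀ : ℕ) : ℝ) + 1) ^ q)) :=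
  astar_sub_invSq_le_rate_threshold (τ := fun k => T₀ / ((k : ℝ) + 1) ^ q) (A₁ := 4) (A₂ := T₀ * (4 / (1 - q) + 2 / q))
    hβ hb hγ hρ0 hρW hsmall (fun k => by positivity) (fun _ _ hkl => powerTail_antitone hT₀ hq0.le hkl) hτ (by norm_num)
    (fun K N hK => powerTail_T1 hq0 hq1 hT₀ hτ K N hK) (fun j₀ => powerTail_T2 hq0 hq1 j₀) hrun hbox hpin hσ₀ hm hn

/-- **THE LOWER SIDE FOR EVERY POWER TAIL (no smallness).**  Same family (`b > 0`, `ρ ≥ 0`, `Σ_{a<N} ρ_a ≤ W`) with a power-tail MINORANT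
`T₁∕(k+1)^q ≤ Σ_{a<N} ρ(a) − Σ_{a<k} ρ(a)` for `k ≥ 1`, `N ≥ 2k` (`T₁ ≥ 0`, `q ≥ 0`); THEN for `1 ≤ m ≤ n+1` SOME `m′ ≤ m` has
`√m·T₁∕(n+m+1)^q ≤ 8κ₂√b₂(1+Wγ∕b)·(astar g m′ − invSq g m′ (n+m−m′))` (fourth file). [cite: Balaban1987RG1, (0.20) p.256, (0.31) and Thm 2 p.259] -/
theorem powerTail_rate_lower {T₁ q : ℝ}
    (hβ : ∀ (k : ℕ) (p : Fin (k + 1) → ℝ),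
      β k p = b + ∑ i : Fin (k + 1), ρ (k - i) * min (p (Fin.last k)) (|p (Fin.last k) - p i|))
    (hb : 0 < b) (hγ : 0 < γ) (hρ0 : ∀ a, 0 ≤ ρ a) (hρW : ∀ n, ∑ a ∈ range n, ρ a ≤ W) (hq : 0 ≤ q) (hT₁ : 0 ≤ T₁)
    (hτ' : ∀ k N : ℕ, 1 ≤ k → 2 * k ≤ N → T₁ / ((k : ℝ) + 1) ^ q ≤ ∑ a ∈ range N, ρ a - ∑ a ∈ range k, ρ a)
    {g : ℕ → ℕ → ℝ} {gIR : ℝ} (hrun : ∀ K, RGEqH K β (g K)) (hbox : ∀ K i, i ≤ K → 0 < g K i ∧ g K i ≤ γ)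
    (hpin : ∀ K, g K K = gIR) {m n : ℕ} (hm : 1 ≤ m) (hmn : m ≤ n + 1) :
    ∃ m', m' ≤ m ∧
      Real.sqrt (m : ℝ) * (T₁ / ((((n + m : ℕ) : ℝ)) + 1) ^ q)
        ≤ 8 * ((1 / gIR ^ 2 + (b + W * γ)) / b) * Real.sqrt (1 / gIR ^ 2 + (b + W * γ)) * (1 + W * γ / b)
          * (astar g m' - invSq g m' (n + m - m')) :=
  astar_sub_invSq_rate_lower (τ' := fun k => T₁ / ((k : ℝ) + 1) ^ q) hβ hb hγ hρ0 hρW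
    (fun _ _ hkl => powerTail_antitone hT₁ hq hkl) hτ' hrun hbox hpin hm hmn

/-! ## §2 The power profile `ρ(a) = M₀∕((a+1)^q·(a+1))` -/

/-- THE TAILS OF THE POWER PROFILE FROM ABOVE: for `ρ(a) = M₀∕((a+1)^q(a+1))` (`M₀ ≥ 0`, `0 < q ≤ 1`) and `k ≤ N`,
`Σ_{a<N} ρ(a) − Σ_{a<k} ρ(a) ≤ M₀(1 + 2∕q)∕(k+1)^q` (`k = 0`: the term `a = 0` plus the seventh file's `(1+q)`-tail; `k ≥ 1`: the
`(1+q)`-tail telescoped from `k + 1`, `≤ M₀∕(q·k^q) ≤ 2M₀∕(q(k+1)^q)`). [folklore] -/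
theorem powerProfile_tail_le {M₀ q : ℝ} (hM₀ : 0 ≤ M₀) (hq0 : 0 < q) (hq1 : q ≤ 1)
    (hρ : ∀ a, ρ a = M₀ / ((((a : ℝ) + 1) ^ q) * ((a : ℝ) + 1))) {k N : ℕ} (hkN : k ≤ N) :
    ∑ a ∈ range N, ρ a - ∑ a ∈ range k, ρ a ≤ M₀ * (1 + 2 / q) / ((k : ℝ) + 1) ^ q := by
  have hρ0 : ∀ a, 0 ≤ ρ a := fun a => by rw [hρ a]; positivity
  rw [← Finset.sum_Ico_eq_sub _ hkN]
  have hk1 : (0 : ℝ) < (k : ℝ) + 1 := by positivity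
  have hk1q : 0 < ((k : ℝ) + 1) ^ q := Real.rpow_pos_of_pos hk1 q
  -- the telescoped tail from any start `k ≥ 1`: `Σ_{a∈[k,N)} 1∕((a+1)^q(a+1)) ≤ 1∕(q·k^q)`
  have htail : ∀ k' N' : ℕ, 1 ≤ k' → k' ≤ N' →
      ∑ a ∈ Ico k' N', 1 / ((((a : ℝ) + 1) ^ q) * ((a : ℝ) + 1)) ≤ 1 / (q * (k' : ℝ) ^ q) := by
    intro k' N' hk' hk'N'
    have hk'0 : (0 : ℝ) < k' := by exact_mod_cast hk'
    have hk'q : 0 < (k' : ℝ) ^ q := Real.rpow_pos_of_pos hk'0 q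
    obtain ⟨d, rfl⟩ := Nat.exists_eq_add_of_le hk'N'
    have hsum : ∑ a ∈ Ico k' (k' + d), q / ((((a : ℝ) + 1) ^ q) * ((a : ℝ) + 1))
        ≤ 1 / (k' : ℝ) ^ q := by
      rw [Finset.sum_Ico_eq_sum_range, show k' + d - k' = d by omega]
      calc ∑ t ∈ range d, q / (((((k' + t : ℕ) : ℝ) + 1) ^ q) * (((k' + t : ℕ) : ℝ) + 1))
          ≤ ∑ t ∈ range d, (1 / (((k' + t : ℕ) : ℝ)) ^ q - 1 / ((((k' + t : ℕ) : ℝ)) + 1) ^ q) := by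
            refine sum_le_sum fun t _ => ?_
            have hk'1 : (1 : ℝ) ≤ k' := by exact_mod_cast hk'
            have h := tail_step (v := ((k' + t : ℕ) : ℝ) + 1) hq0 hq1
              (by push_cast; have : (0 : ℝ) ≤ t := Nat.cast_nonneg t; linarith)
            rwa [add_sub_cancel_right] at h
        _ = ∑ t ∈ range d, ((fun t : ℕ => 1 / ((k' : ℝ) + t) ^ q) t - (fun t : ℕ => 1 / ((k' : ℝ) + t) ^ q) (t + 1)) := by
            refine sum_congr rfl fun t _ => ?_
            push_cast
            ring_nf
        _ = 1 / ((k' : ℝ) + ((0 : ℕ) : ℝ)) ^ q - 1 / ((k' : ℝ) + ((d : ℕ) : ℝ)) ^ q := Finset.sum_range_sub' _ d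
        _ ≤ 1 / (k' : ℝ) ^ q := by
            rw [Nat.cast_zero, add_zero]
            have : 0 ≤ 1 / ((k' : ℝ) + (d : ℝ)) ^ q := by positivity
            linarith
    rw [le_div_iff₀ (mul_pos hq0 hk'q)]
    calc (∑ a ∈ Ico k' (k' + d), 1 / ((((a : ℝ) + 1) ^ q) * ((a : ℝ) + 1))) * (q * (k' : ℝ) ^ q)
        = (∑ a ∈ Ico k' (k' + d), q / ((((a : ℝ) + 1) ^ q) * ((a : ℝ) + 1))) * (k' : ℝ) ^ q := by
          rw [Finset.sum_mul, Finset.sum_mul]; exact sum_congr rfl fun a _ => by ring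
      _ ≤ 1 / (k' : ℝ) ^ q * (k' : ℝ) ^ q := mul_le_mul_of_nonneg_right hsum hk'q.le
      _ = 1 := by field_simp
  have hscale : ∑ a ∈ Ico k N, ρ a = M₀ * ∑ a ∈ Ico k N, 1 / ((((a : ℝ) + 1) ^ q) * ((a : ℝ) + 1)) := by
    rw [Finset.mul_sum]; exact sum_congr rfl fun a _ => by rw [hρ a]; ring
  rcases Nat.eq_zero_or_pos k with hk | hk
  · -- `k = 0`: the `a = 0` term is `M₀`, the rest `≤ M₀∕q`
    subst hk
    simp only [Nat.cast_zero, zero_add, Real.one_rpow, div_one]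
    rcases Nat.eq_zero_or_pos N with hN | hN
    · subst hN; simp; nlinarith [div_nonneg (by norm_num : (0:ℝ) ≤ 2) hq0.le]
    · rw [hscale, Finset.sum_eq_sum_Ico_succ_bot hN]
      simp only [Nat.cast_zero, zero_add, Real.one_rpow, one_mul, div_one]
      have h1 := htail 1 N le_rfl hN
      simp only [Nat.cast_one, Real.one_rpow, mul_one] at h1
      have : 1 + ∑ a ∈ Ico 1 N, 1 / ((((a : ℝ) + 1) ^ q) * ((a : ℝ) + 1)) ≤ 1 + 2 / q := by
        have : 1 / q ≤ 2 / q := div_le_div_of_nonneg_right (by norm_num) hq0.le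
        linarith
      exact mul_le_mul_of_nonneg_left this hM₀
  · -- `k ≥ 1`
    have hk0 : (0 : ℝ) < k := by exact_mod_cast hk
    have hkq : 0 < (k : ℝ) ^ q := Real.rpow_pos_of_pos hk0 q
    have h1 := htail k N hk hkN
    -- `1∕(q k^q) ≤ 2∕(q (k+1)^q)` since `(k+1)^q ≤ (2k)^q = 2^q k^q ≤ 2 k^q`
    have h2q : (2 : ℝ) ^ q ≤ 2 := by
      have := Real.rpow_le_rpow_of_exponent_le (x := 2) (by norm_num) hq1
      rwa [Real.rpow_one] at this
    have hkk : ((k : ℝ) + 1) ^ q ≤ 2 * (k : ℝ) ^ q := by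
      have hk1' : (1 : ℝ) ≤ k := by exact_mod_cast hk
      calc ((k : ℝ) + 1) ^ q ≤ (2 * (k : ℝ)) ^ q := Real.rpow_le_rpow hk1.le (by linarith) hq0.le
        _ = 2 ^ q * (k : ℝ) ^ q := Real.mul_rpow (by norm_num) hk0.le
        _ ≤ 2 * (k : ℝ) ^ q := mul_le_mul_of_nonneg_right h2q hkq.le
    have h2 : 1 / (q * (k : ℝ) ^ q) ≤ (2 / q) / ((k : ℝ) + 1) ^ q := by
      rw [div_div, div_le_div_iff₀ (by positivity) (by positivity)]
      nlinarith [hq0]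
    rw [hscale]
    calc M₀ * ∑ a ∈ Ico k N, 1 / ((((a : ℝ) + 1) ^ q) * ((a : ℝ) + 1)) ≤ M₀ * ((2 / q) / ((k : ℝ) + 1) ^ q) :=
          mul_le_mul_of_nonneg_left (h1.trans h2) hM₀
      _ ≤ M₀ * (1 + 2 / q) / ((k : ℝ) + 1) ^ q := by
          rw [mul_div_assoc]
          refine mul_le_mul_of_nonneg_left (div_le_div_of_nonneg_right (by linarith) hk1q.le) hM₀

/-- THE TAILS OF THE POWER PROFILE FROM BELOW: for the same profile (`M₀ ≥ 0`, `0 ≤ q ≤ 1`), `k ≥ 1` and `N ≥ 2k`: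
`(M₀∕4)∕(k+1)^q ≤ Σ_{a<N} ρ(a) − Σ_{a<k} ρ(a)` (the block `a ∈ [k, 2k)` has `k` terms each `≥ M₀∕((2k)^q·2k)`, and `(2k)^q ≤ 2(k+1)^q`). [folklore] -/
theorem powerProfile_tail_ge {M₀ q : ℝ} (hM₀ : 0 ≤ M₀) (hq0 : 0 ≤ q) (hq1 : q ≤ 1)
    (hρ : ∀ a, ρ a = M₀ / ((((a : ℝ) + 1) ^ q) * ((a : ℝ) + 1))) {k N : ℕ} (hk : 1 ≤ k) (hkN : 2 * k ≤ N) :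
    M₀ / 4 / ((k : ℝ) + 1) ^ q ≤ ∑ a ∈ range N, ρ a - ∑ a ∈ range k, ρ a := by
  have hρ0 : ∀ a, 0 ≤ ρ a := fun a => by rw [hρ a]; positivity
  rw [← Finset.sum_Ico_eq_sub _ (by omega : k ≤ N)]
  have hk0 : (0 : ℝ) < k := by exact_mod_cast hk
  have h2k : (0 : ℝ) < 2 * (k : ℝ) := by positivity
  have h2kq : 0 < (2 * (k : ℝ)) ^ q := Real.rpow_pos_of_pos h2k q
  have hk1q : 0 < ((k : ℝ) + 1) ^ q := Real.rpow_pos_of_pos (by positivity) q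
  have hblock : ∑ a ∈ Ico k (2 * k), ρ a ≤ ∑ a ∈ Ico k N, ρ a :=
    Finset.sum_le_sum_of_subset_of_nonneg (Finset.Ico_subset_Ico_right hkN) fun a _ _ => hρ0 a
  have hterm : ∀ a ∈ Ico k (2 * k), M₀ / ((2 * (k : ℝ)) ^ q * (2 * (k : ℝ))) ≤ ρ a := by
    intro a ha
    have ha' := (Finset.mem_Ico.mp ha).2
    have ha1 : (a : ℝ) + 1 ≤ 2 * k := by exact_mod_cast (by omega : a + 1 ≤ 2 * k)
    have ha0 : (0 : ℝ) < (a : ℝ) + 1 := by positivity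
    rw [hρ a]
    refine div_le_div_of_nonneg_left hM₀ (by positivity) ?_
    exact mul_le_mul (Real.rpow_le_rpow ha0.le ha1 hq0) ha1 ha0.le h2kq.le
  have hsum := Finset.card_nsmul_le_sum (Ico k (2 * k)) ρ _ hterm
  rw [Nat.card_Ico, show 2 * k - k = k by omega, nsmul_eq_mul] at hsum
  refine le_trans ?_ (hsum.trans hblock)
  -- `(M₀∕4)∕(k+1)^q ≤ k·M₀∕((2k)^q·2k) = (M₀∕2)∕(2k)^q`, i.e. `(2k)^q ≤ 2(k+1)^q`
  have e : (k : ℝ) * (M₀ / ((2 * (k : ℝ)) ^ q * (2 * (k : ℝ)))) = M₀ / 2 / (2 * (k : ℝ)) ^ q := by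
    field_simp
  rw [e]
  have h2q : (2 : ℝ) ^ q ≤ 2 := by
    have := Real.rpow_le_rpow_of_exponent_le (x := 2) (by norm_num) hq1
    rwa [Real.rpow_one] at this
  have h2kle : (2 * (k : ℝ)) ^ q ≤ 2 * ((k : ℝ) + 1) ^ q := by
    calc (2 * (k : ℝ)) ^ q ≤ (2 * ((k : ℝ) + 1)) ^ q := Real.rpow_le_rpow h2k.le (by linarith) hq0
      _ = 2 ^ q * ((k : ℝ) + 1) ^ q := Real.mul_rpow (by norm_num) (by positivity)
      _ ≤ 2 * ((k : ℝ) + 1) ^ q := mul_le_mul_of_nonneg_right h2q hk1q.le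
  rw [div_le_div_iff₀ hk1q h2kq]
  nlinarith [hM₀, h2kle, hk1q.le]

/-- **ROAD P3 — THE RATE IN THE CUTOFF FOR THE POWER PROFILE `ρ(a) = M₀∕(a+1)^{1+q}`, UPPER SIDE.**  A pinned family of runs of the
order-0 profile family with `ρ(a) = M₀∕((a+1)^q(a+1))` (`M₀ > 0`, `0 < q < 1`), in ]0,γ], `Σ_{a<N} ρ_a ≤ W`, `Wγ < b`; with `T₀ = M₀(1+2∕q)`:
for every `m` with `T₀(4∕(1−q) + 2∕q) ≤ b√b·√m` and every `n ≥ m − 1`, `0 ≤ astar g m − invSq g m n ≤ Λ₄·√m·T₀∕(n+2)^q`.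
[cite: Balaban1987RG1, (0.20) p.256, (0.31) and Thm 2 p.259] -/
theorem powerProfile_rate {M₀ q : ℝ}
    (hβ : ∀ (k : ℕ) (p : Fin (k + 1) → ℝ),
      β k p = b + ∑ i : Fin (k + 1), ρ (k - i) * min (p (Fin.last k)) (|p (Fin.last k) - p i|))
    (hb : 0 < b) (hγ : 0 < γ) (hM₀ : 0 < M₀) (hq0 : 0 < q) (hq1 : q < 1)
    (hρ : ∀ a, ρ a = M₀ / ((((a : ℝ) + 1) ^ q) * ((a : ℝ) + 1)))
    (hρW : ∀ n, ∑ a ∈ range n, ρ a ≤ W) (hsmall : W * γ < b)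
    {g : ℕ → ℕ → ℝ} {gIR : ℝ} (hrun : ∀ K, RGEqH K β (g K)) (hbox : ∀ K i, i ≤ K → 0 < g K i ∧ g K i ≤ γ)
    (hpin : ∀ K, g K K = gIR) {m n : ℕ}
    (hm : M₀ * (1 + 2 / q) * (4 / (1 - q) + 2 / q) ≤ b * Real.sqrt b * Real.sqrt (m : ℝ)) (hmn : m ≤ n + 1) :
    0 ≤ astar g m - invSq g m n ∧ astar g m - invSq g m n
      ≤ (4 / Real.sqrt b + 8 * Real.sqrt 2 * ((b + W * γ) / b) * 4 / ((1 - W * γ / b) * Real.sqrt b))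
        * Real.sqrt (m : ℝ) * (M₀ * (1 + 2 / q) / ((((n + 1 : ℕ) : ℝ)) + 1) ^ q) := by
  have hρ0 : ∀ a, 0 ≤ ρ a := fun a => by rw [hρ a]; positivity
  have hT₀ : 0 ≤ M₀ * (1 + 2 / q) := by positivity
  exact powerTail_rate hβ hb hγ hρ0 hρW hsmall hq0 hq1 hT₀
    (fun k N hkN => powerProfile_tail_le hM₀.le hq0 hq1.le hρ hkN) hrun hbox hpin hm hmn

/-- **ROAD P3 — THE RATE IN THE CUTOFF FOR THE POWER PROFILE, LOWER SIDE (no smallness).**  Same family (`M₀ > 0`, `0 ≤ q ≤ 1`,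
`Σ_{a<N} ρ_a ≤ W`); for `1 ≤ m ≤ n+1` SOME `m′ ≤ m` has `√m·(M₀∕4)∕(n+m+1)^q ≤ 8κ₂√b₂(1+Wγ∕b)·(astar g m′ − invSq g m′ (n+m−m′))`.  With
`powerProfile_rate`: road P3's polynomial profiles reach their continuum coupling at the two-sided rate `√m∕n^q`.
[cite: Balaban1987RG1, (0.20) p.256, (0.31) and Thm 2 p.259] -/
theorem powerProfile_rate_lower {M₀ q : ℝ}
    (hβ : ∀ (k : ℕ) (p : Fin (k + 1) → ℝ),
      β k p = b + ∑ i : Fin (k + 1), ρ (k - i) * min (p (Fin.last k)) (|p (Fin.last k) - p i|))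
    (hb : 0 < b) (hγ : 0 < γ) (hM₀ : 0 < M₀) (hq0 : 0 ≤ q) (hq1 : q ≤ 1)
    (hρ : ∀ a, ρ a = M₀ / ((((a : ℝ) + 1) ^ q) * ((a : ℝ) + 1)))
    (hρW : ∀ n, ∑ a ∈ range n, ρ a ≤ W)
    {g : ℕ → ℕ → ℝ} {gIR : ℝ} (hrun : ∀ K, RGEqH K β (g K)) (hbox : ∀ K i, i ≤ K → 0 < g K i ∧ g K i ≤ γ)
    (hpin : ∀ K, g K K = gIR) {m n : ℕ} (hm : 1 ≤ m) (hmn : m ≤ n + 1) :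
    ∃ m', m' ≤ m ∧
      Real.sqrt (m : ℝ) * (M₀ / 4 / ((((n + m : ℕ) : ℝ)) + 1) ^ q)
        ≤ 8 * ((1 / gIR ^ 2 + (b + W * γ)) / b) * Real.sqrt (1 / gIR ^ 2 + (b + W * γ)) * (1 + W * γ / b)
          * (astar g m' - invSq g m' (n + m - m')) := by
  have hρ0 : ∀ a, 0 ≤ ρ a := fun a => by rw [hρ a]; positivity
  exact powerTail_rate_lower hβ hb hγ hρ0 hρW hq0 (by positivity : 0 ≤ M₀ / 4)
    (fun k N hk hkN => powerProfile_tail_ge hM₀.le hq0 hq1 hρ hk hkN) hrun hbox hpin hm hmn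

end Summit.QuantumFields.BalabanUV.Beta.RemainderExplicitHistoryDiagonalRatePowerTail

end
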